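import Literature.NumberTheory.Sieve.RoughOmegaCellsAsymptotic
import Literature.NumberTheory.Sieve.RoughCellDensity
import Literature.NumberTheory.LFunctions.PrimesIntervalMainTerm
import HarnessLib

/-!
# Ω-cells of the rough integers: Alladi's asymptotic with the explicit densities `I_j`

Topic `Literature/NumberTheory/Sieve`. Everything here is PROVED. The abstract theorem
`exists_abs_cell_sub_main_le` (`RoughOmegaCellsAsymptotic.lean`: Alladi's asymptotic for the
`Ω`-cells of the rough integers with the rate `O(X/log² Y)`, for ANY density family satisfying the
Alladi–Buchstab recursion, given the prime number theorem in `(X, Y)`-format) is instantiated with the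
tree's cell densities `I_j = roughCellDensity j` (`RoughCellDensity.lean`) and the tree's prime number
theorem `exists_abs_card_primes_Icc_ceil_floor_sub_le` (`PrimesIntervalMainTerm.lean`):

* `exists_abs_roughCell_sub_main_le` — for every `i, k` there is `C ≥ 0` with
  `|#{b ∈ roughIcc ⌈Y⌉ ⌊X⌋ : Ω b = i+1} − (X I_{i+1}(u)/log X − [i = 0] Y/log Y)| ≤ C X/log² Y`
  for all `2 ≤ Y ≤ X` with `log X ≤ k log Y`, `u = log X/log Y`.

The density family fed to the abstract theorem is `F_0 = 1`, `F_{i+1} = I_{i+2}` (the abstract theorem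
wants `F_0 ≡ 1` on all of `ℝ`, whereas `I_1 = 𝟙_{[1,∞)}`; the two agree at `u = log X/log Y ≥ 1`).

## References

* K. Alladi, *The distribution of ν(n) in the sieve of Eratosthenes*, Quart. J. Math. Oxford (2) 33
  (1982), 129–148, Theorem 1. [Alladi1982]
* G. Tenenbaum, *Introduction to analytic and probabilistic number theory*, Ch. III.6. [Tenenbaum2015]
-/

open Finset Real MeasureTheory Set
open scoped ArithmeticFunction.Omega

noncomputable section

namespace Literature.NumberTheory.Sieve

/-- **Alladi's asymptotic for the `Ω`-cells of the rough integers, with a rate, for the explicit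
densities `I_j = roughCellDensity j`**: for every `i, k` there is `C ≥ 0` such that
`|#{b ∈ roughIcc ⌈Y⌉ ⌊X⌋ : Ω b = i+1} − (X I_{i+1}(log X/log Y)/log X − [i = 0] Y/log Y)| ≤ C X/log² Y`
for all `2 ≤ Y ≤ X` with `log X ≤ k log Y` (`exists_abs_cell_sub_main_le` for the family
`F_0 = 1`, `F_{i+1} = I_{i+2}`, and the prime number theorem `exists_abs_card_primes_Icc_ceil_floor_sub_le`;
for `i = 0`, `I_1(u) = 1` as `u ≥ 1`). [cite: Alladi1982, Theorem 1] -/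
theorem exists_abs_roughCell_sub_main_le (i k : ℕ) :
    ∃ C : ℝ, 0 ≤ C ∧ ∀ X Y : ℝ, 2 ≤ Y → Y ≤ X → Real.log X ≤ k * Real.log Y →
      |((((roughIcc ⌈Y⌉₊ ⌊X⌋₊).filter
          (fun b => ArithmeticFunction.cardFactors b = i + 1)).card : ℕ) : ℝ) -
        (X * roughCellDensity (i + 1) (Real.log X / Real.log Y) / Real.log X -
          if i = 0 then Y / Real.log Y else 0)| ≤
        C * X / Real.log Y ^ 2 := by
  -- the density family `F_0 = 1`, `F_{i+1} = I_{i+2}` and the hypotheses of the abstract theorem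
  set F : ℕ → ℝ → ℝ := fun i s => if i = 0 then 1 else roughCellDensity (i + 1) s with hF_def
  have hF0 : ∀ s, F 0 s = 1 := fun s => by simp [hF_def]
  have hFS : ∀ i, F (i + 1) = roughCellDensity (i + 2) := fun i => by
    funext s; simp [hF_def]
  have hFc : ∀ i, ContinuousOn (F i) (Set.Ici 1) := by
    intro i
    cases i with
    | zero => exact continuousOn_const.congr fun s _ => hF0 s
    | succ i => rw [hFS]; exact continuousOn_roughCellDensity (by omega)
  have hFz : ∀ (i : ℕ) (v : ℝ), v ≤ (i : ℝ) + 2 → F (i + 1) v = 0 := by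
    intro i v hv
    rw [hFS]
    exact roughCellDensity_of_le (by omega) (by push_cast; linarith)
  have hFrec : ∀ (i : ℕ) (v : ℝ), 2 ≤ v → F (i + 1) v = ∫ s in (1 : ℝ)..(v - 1), F i s / s := by
    intro i v hv
    rw [hFS]
    cases i with
    | zero =>
      rw [show (0 : ℕ) + 2 = 1 + 1 from rfl, roughCellDensity_succ le_rfl]
      refine intervalIntegral.integral_congr fun s hs => ?_
      rw [Set.uIcc_of_le (by linarith)] at hs
      simp only [hF0]
      rw [roughCellDensity_one_of_one_le hs.1]
    | succ i =>
      rw [hFS, show i + 1 + 2 = (i + 2) + 1 from rfl, roughCellDensity_succ (by omega)]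
  have hFd : ∀ (i : ℕ) (s : ℝ), 2 < s → HasDerivAt (F (i + 1)) (F i (s - 1) / (s - 1)) s := by
    intro i s hs
    rw [hFS]
    cases i with
    | zero =>
      have h := hasDerivAt_roughCellDensity_succ (j := 1) le_rfl hs
      simp only [hF0]
      rwa [roughCellDensity_one_of_one_le (by linarith)] at h
    | succ i =>
      rw [hFS]
      exact hasDerivAt_roughCellDensity_succ (j := i + 2) (by omega) hs
  obtain ⟨Cp, hCp0, hCp⟩ := Literature.NumberTheory.LFunctions.exists_abs_card_primes_Icc_ceil_floor_sub_le
  have hprime : ∀ k : ℕ, ∃ C : ℝ, 0 ≤ C ∧ ∀ X Y : ℝ, 2 ≤ Y → Y ≤ X →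
      Real.log X ≤ k * Real.log Y →
      |((((Finset.Icc ⌈Y⌉₊ ⌊X⌋₊).filter Nat.Prime).card : ℕ) : ℝ) -
        (X / Real.log X - Y / Real.log Y)| ≤ C * X / Real.log Y ^ 2 :=
    fun _ => ⟨Cp, hCp0, fun X Y hY hYX _ => hCp X Y hY hYX⟩
  obtain ⟨C, hC, h⟩ := exists_abs_cell_sub_main_le hF0 hFc hFz hFrec hFd hprime i k
  refine ⟨C, hC, fun X Y hY hYX hXY => ?_⟩
  have h' := h X Y hY hYX hXY
  cases i with
  | zero =>
    have hlY : 0 < Real.log Y := Real.log_pos (by linarith)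
    have hu : 1 ≤ Real.log X / Real.log Y := by
      rw [le_div_iff₀ hlY, one_mul]
      exact Real.log_le_log (by linarith) hYX
    rw [show (0 : ℕ) + 1 = 1 from rfl, roughCellDensity_one_of_one_le hu]
    simpa [hF0] using h'
  | succ i =>
    rw [show i + 1 + 1 = i + 2 from rfl, ← hFS]
    exact h'


/-- **The rough prime cell from below, with a rate** (corollary of `exists_abs_roughCell_sub_main_le` at
`i = 0`, `k = 2`, `X = N`, `Y = ⌊N^{1/2}⌋ + 1`): there is `C ≥ 0` with
`N/log N − C N/log² N ≤ #{b ∈ roughIcc (⌊N^{1/2}⌋+1) N : Ω b = 1}` (`= π(N) − π(N^{1/2})`) for all `N ≥ 3`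
(`Y/log Y ≤ 4N^{1/2}/log N`, `N/log² Y ≤ 4N/log² N`, `log N ≤ 2N^{1/2}`). [cite: Alladi1982, Theorem 1] -/
theorem le_card_roughIcc_sqrt_cardFactors_one :
    ∃ C : ℝ, 0 ≤ C ∧ ∀ N : ℕ, 3 ≤ N →
      (N : ℝ) / Real.log N - C * N / Real.log N ^ 2 ≤
        ((((roughIcc (⌊(N : ℝ) ^ ((1 : ℝ) / 2)⌋₊ + 1) N).filter
          (fun b => ArithmeticFunction.cardFactors b = 1)).card : ℕ) : ℝ) := by
  obtain ⟨C, hC0, hC⟩ := exists_abs_roughCell_sub_main_le 0 2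
  refine ⟨4 * C + 8, by positivity, fun N hN => ?_⟩
  have hN0 : (0 : ℝ) < N := by exact_mod_cast (by omega : 0 < N)
  have hN1 : (1 : ℝ) < N := by exact_mod_cast (by omega : 1 < N)
  set r : ℝ := (N : ℝ) ^ ((1 : ℝ) / 2) with hr
  have hr0 : 0 < r := Real.rpow_pos_of_pos hN0 _
  have hrsq : r ^ 2 = N := by
    rw [hr, ← Real.rpow_natCast, ← Real.rpow_mul hN0.le]; norm_num
  have hr1 : 1 ≤ r := by
    rw [hr]; exact Real.one_le_rpow hN1.le (by norm_num)
  have hlogN : 0 < Real.log N := Real.log_pos hN1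
  have hlogr : Real.log r = Real.log N / 2 := by
    rw [hr, Real.log_rpow hN0]; ring
  set Yn : ℕ := ⌊r⌋₊ + 1 with hYn
  set Y : ℝ := (Yn : ℝ) with hY
  have hYr : r < Y := by rw [hY, hYn]; push_cast; exact Nat.lt_floor_add_one r
  have hYle : Y ≤ r + 1 := by
    rw [hY, hYn]; push_cast; linarith [Nat.floor_le hr0.le]
  have hY2 : (2 : ℝ) ≤ Y := by
    rw [hY, hYn]; push_cast
    have : (1 : ℕ) ≤ ⌊r⌋₊ := Nat.le_floor (by exact_mod_cast hr1)
    exact_mod_cast (by omega : 2 ≤ ⌊r⌋₊ + 1)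
  have hY0 : 0 < Y := by linarith
  have hN3 : (3 : ℝ) ≤ N := by exact_mod_cast hN
  have hr16 : (8 : ℝ) / 5 ≤ r := by
    by_contra h
    push Not at h
    have : r ^ 2 < (8 / 5) ^ 2 := by gcongr
    rw [hrsq] at this
    norm_num at this; linarith
  have hYN : Y ≤ N := by
    have h3r : 3 ≤ r ^ 2 := by rw [hrsq]; exact hN3
    have : r + 1 ≤ r ^ 2 := by nlinarith
    linarith [hrsq ▸ this]
  have hlogY : 0 < Real.log Y := Real.log_pos (by linarith)
  have hlogYge : Real.log N / 2 ≤ Real.log Y := by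
    rw [← hlogr]; exact Real.log_le_log hr0 hYr.le
  have hlogYle : Real.log Y ≤ Real.log N := Real.log_le_log hY0 hYN
  have hk : Real.log (N : ℝ) ≤ (2 : ℕ) * Real.log Y := by push_cast; linarith
  have hA := hC (N : ℝ) Y hY2 hYN hk
  have hceil : ⌈Y⌉₊ = Yn := by rw [hY, Nat.ceil_natCast]
  have hfloor : ⌊(N : ℝ)⌋₊ = N := Nat.floor_natCast N
  rw [hceil, hfloor, zero_add] at hA
  have hI : roughCellDensity 1 (Real.log N / Real.log Y) = 1 :=
    roughCellDensity_one_of_one_le ((one_le_div hlogY).mpr hlogYle)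
  rw [hI, if_pos rfl, mul_one] at hA
  have hlow := (abs_le.mp hA).1
  have h1 : Y / Real.log Y ≤ 4 * r / Real.log N := by
    rw [div_le_div_iff₀ hlogY hlogN]
    have : Y ≤ 2 * r := by linarith
    calc Y * Real.log N ≤ 2 * r * Real.log N := by gcongr
      _ = 4 * r * (Real.log N / 2) := by ring
      _ ≤ 4 * r * Real.log Y := by gcongr
  have h2 : C * N / Real.log Y ^ 2 ≤ 4 * C * N / Real.log N ^ 2 := by
    rw [div_le_div_iff₀ (by positivity) (by positivity)]
    have hsq : Real.log N ^ 2 ≤ 4 * Real.log Y ^ 2 := by nlinarith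
    calc C * N * Real.log N ^ 2 ≤ C * N * (4 * Real.log Y ^ 2) := by gcongr
      _ = 4 * C * N * Real.log Y ^ 2 := by ring
  have hlog2r : Real.log N ≤ 2 * r := by
    have h := Real.log_le_rpow_div hN0.le (by norm_num : (0 : ℝ) < 1 / 2)
    rw [← hr] at h
    linarith [show r / (1 / 2) = 2 * r by ring]
  have h3 : 4 * r / Real.log N ≤ 8 * N / Real.log N ^ 2 := by
    rw [div_le_div_iff₀ hlogN (by positivity)]
    calc 4 * r * Real.log N ^ 2 = 4 * r * Real.log N * Real.log N := by ring
      _ ≤ 4 * r * (2 * r) * Real.log N := by gcongr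
      _ = 8 * r ^ 2 * Real.log N := by ring
      _ = 8 * N * Real.log N := by rw [hrsq]
  have e : (4 * C + 8) * N / Real.log N ^ 2 = 4 * C * N / Real.log N ^ 2 + 8 * N / Real.log N ^ 2 := by
    ring
  rw [e]
  linarith

end Literature.NumberTheory.Sieve
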